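import Summits.AtomisticToContinuum.HydrodynamicLimit.Theorems.InformationPercolationEnginePercolationClosesChaosDockingDisplacement
import Summits.AtomisticToContinuum.HydrodynamicLimit.Theorems.InformationPercolationEnginePercolationClosesChaosDockingTail
import Summits.AtomisticToContinuum.HydrodynamicLimit.Theorems.InformationPercolationEnginePercolationClosesChaosDockingOwners
import HarnessLib

/-!
# Docking S7 of the line `equilibrium-forecast-chain-rule` (crux `InformationPercolationEngine.PercolationClosesChaos`,
stmt-AtomisticToContinuum-15178) — piece F2b: the deterministic bound of the target's defect on a good orbit

Support file (`--supports stmt-AtomisticToContinuum-15178`) of the registered stub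
`stub_docking : KineticCellChaosLG → NoMesoscopicOscillation → LocalCountUI → ContactChaos` (worker S7 of lead c3).
Two registered helpers, both deterministic statements at ONE good initial datum `z`:

* `abs_sum_dockSummand_step_le` (one step `k`, `(k+1)Δ ≤ S`, in the box-sum currency of the line):
  `|Σ_{triples of step k} dockSummand| ≤ (n̄c) · [Cχ NMO_k + Cχ S₁ (2η₁ R_k + 2CΨ BW_k + 4CΨ U_k) + α R_k + 2Cχ C_P U_k
  + β Δ √(T₂ R_k) √(2E(z))]` — frozen main terms regrouped by start cell (`sum_dockMain_eq`, `abs_stepMain_le`) with the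
  cross-ratio defect regrouped by owner (`sum_collPair_mul_abs_relDefect_le`, `ownedCount ≤ 2 rowCount`); good rows
  (`rowCount (start cell) ≤ T₂`) by the per-collision replacement `abs_dockSummand_sub_dockMain_le` and the in-step path
  lengths `sum_stepPath_good_le` (F1); bad rows by the crude bounds and `card_filter_bad_eq`. `NMO_k, R_k, BW_k, U_k` are the
  box sums at step `k` of the `NoMesoscopicOscillation` (i) integrand, of `rowCount`, of `badWeight Ψ η₁ (2T₂)` and of
  `rowCount · 𝟙{T₂ < rowCount}`; `α, β, C_P = CΨ S₁ + S_Ψ` are the constants of the replacement inequality;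
* `abs_dockDefect_le` (the whole defect, no pair in contact at time `0`, `Δ ≤ τ`, `Δ ≤ 1`, `τ + Δ ≤ S`, an energy constant
  `Q ≥ 0` with `2 T₂ h³ E(z) ≤ Q²`, and the three GOOD-EVENT inequalities of the assembly — unit average of the NMO (i)
  integrand `≤ ηN`, of `badWeight Ψ η₁ (2T₂)` `≤ b₁`, of `rowCount 𝟙{T₂ < rowCount}` over the DOUBLED horizon `2τ` `≤ b₂`):
  `|dockDefect| ≤ π σ³ · BOUND`, `BOUND` EXACTLY the bracket of the smallness budget `docking_budget` (piece F0) — time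
  tiling (`dockDefect_eq_sum`), the step bound for `k < K_N` and the tail bound (`abs_sum_dockSummand_tail_le`, piece F2a),
  the dictionary `ε/(N+1)·(n̄c) = πσ³Δh³` (`pairWeight_mul_cellCount'`), `stepLen_mul_sum_range_le_unitAvg` with
  `K_N ≤ K_N + 1 ≤ K_{2τ}` (`numSteps_succ_le_numSteps_two_mul`), the level split `mul_sum_rowCount_le`, `K_N Δ ≤ τ`, and
  `h³ √(2T₂R_kE) = √((2T₂h³E)(h³R_k)) ≤ Q √(h³R_k) ≤ Q (1 + h³R_k)` for the path-length term.

Elementary real bookkeeping on the good set (CIP 1994 §4.2).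
-/

noncomputable section

open MeasureTheory Set Filter Topology
open scoped ENNReal BigOperators Classical
open Literature.Analysis.FluidPDE Literature.MathematicalPhysics.KineticTheory
open Literature.MathematicalPhysics.KineticTheory.VelocityBlindPlacement

namespace Summit.AtomisticToContinuum.HydrodynamicLimit.Theorems.EquilibriumForecastLine

/-! ## One step of the defect -/

/-- **Registered helper `abs_sum_dockSummand_step_le` (piece F2a of the docking S7): one step of the defect.** For a step `k` with `(k+1)Δ ≤ S` on a good orbit (hypotheses of the per-collision
replacement `abs_dockSummand_sub_dockMain_le`, continuity of `Ψ`, `σ < 1/2`, a level `T₂ ≥ 0` and a tolerance `η₁ ≥ 0`):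
`|Σ_{triples of step k} dockSummand| ≤ (n̄c) · [Cχ · NMO_k + Cχ S₁ (2η₁ R_k + 2CΨ BW_k + 4CΨ U_k) + α R_k + 2 Cχ C_P U_k
+ β Δ √(T₂ R_k) √(2E(z))]`, where `NMO_k`, `R_k`, `BW_k`, `U_k` are the box sums of the `NoMesoscopicOscillation` (i)
integrand, of `rowCount`, of `badWeight Ψ η₁ (2T₂)` and of `rowCount · 𝟙{T₂ < rowCount}` at step `k`, and `α, β, C_P` are
the constants of the replacement inequality: frozen main terms (`sum_dockMain_eq`, `abs_stepMain_le`, the cross-ratio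
defect by owner `sum_collPair_mul_abs_relDefect_le`, `ownedCount ≤ 2 rowCount`), good rows (replacement + F1
`sum_stepPath_good_le`, `#triples = (n̄c) R_k`), bad rows (crude bounds, `card_filter_bad_eq`). [folklore] -/
theorem abs_sum_dockSummand_step_le : ∀ {σ : ℝ} {N : ℕ} (Φ : Flow σ N) {z : Phase N}, z ∈ Φ.good → ∀ {c : ℝ}, 0 < c → 0 < σ → σ < 2⁻¹ → ∀ (χ : ℝ × T3 → ℝ) {Ψ : V3 × V3 × V3 → ℝ}, Continuous Ψ → ∀ (r τ : ℝ) (k : ℕ) {S Cχ ρ ϖ CΨ S₁ Kt₁ Kx₁ SΨ KtΨ KxΨ T₂ η₁ : ℝ}, ((k : ℝ) + 1) * stepLen c σ N ≤ S → (∀ p : ℝ × T3, p.1 ∈ Icc 0 S → |χ p| ≤ Cχ) → (∀ p p' : ℝ × T3, p.1 ∈ Icc 0 S → p'.1 ∈ Icc 0 S → |p.1 - p'.1| < ϖ → Torus.euclidDist p.2 p'.2 < ϖ → |χ p - χ p'| ≤ ρ) → 0 < ϖ → stepLen c σ N < ϖ / 2 → (∀ p, |Ψ p| ≤ CΨ)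 → (∀ s x, |targetPm (fun _ => 1) r τ σ N Φ z s x| ≤ S₁) → (∀ s x s' x', |targetPm (fun _ => 1) r τ σ N Φ z s x - targetPm (fun _ => 1) r τ σ N Φ z s' x'| ≤ Kt₁ * |s - s'| + Kx₁ * Torus.euclidDist x x') → (∀ s x, |targetPm Ψ r τ σ N Φ z s x| ≤ SΨ) → (∀ s x s' x', |targetPm Ψ r τ σ N Φ z s x - targetPm Ψ r τ σ N Φ z s' x'| ≤ KtΨ * |s - s'| + KxΨ * Torus.euclidDist x x') → 0 ≤ Kt₁ → 0 ≤ Kx₁ → 0 ≤ KtΨ → 0 ≤ KxΨ → 0 ≤ T₂ → 0 ≤ η₁ → |∑ e ∈ collTriples Φ (stepWindow c σ N k) z, dockSummand χ Ψ r τ σ N Φ z e.1 (Φ.flow e.1 z) e.2.1 e.2.2| ≤ (cellCount c σ N * c) * (Cχ * ∑ q ∈ cellBox (c * meanFreePath σ N), (∑' q' : Cell, collPair (fun _ => 1) c σ N Φ k q q' z * |targetPm (fun _ => 1) r τ σ N Φ z ((k : ℝ) * stepLen c σ N) (cellCentre c σ N q) * (pairPair Ψ c σ N Φ k q q' z / pairPair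 (fun _ => 1) c σ N Φ k q q' z) - targetPm Ψ r τ σ N Φ z ((k : ℝ) * stepLen c σ N) (cellCentre c σ N q)|) + Cχ * S₁ * (2 * η₁ * ∑ q ∈ cellBox (c * meanFreePath σ N), rowCount c σ N Φ k q z + 2 * CΨ * ∑ q ∈ cellBox (c * meanFreePath σ N), badWeight Ψ η₁ (2 * T₂) c σ N Φ k q z + 4 * CΨ * ∑ q ∈ cellBox (c * meanFreePath σ N), rowCount c σ N Φ k q z * (if T₂ < rowCount c σ N Φ k q z then 1 else 0)) + (Cχ * (CΨ * Kt₁ + KtΨ) * stepLen c σ N + Cχ * (CΨ * Kx₁ + KxΨ) * (Real.sqrt 3 / 2 * stepLen c σ N) + ρ * (CΨ * S₁ + SΨ)) * ∑ q ∈ cellBox (c * meanFreePath σ N), rowCount c σ N Φ k q z + 2 * (Cχ * (CΨ * S₁ + SΨ)) * ∑ q ∈ cellBox (c * meanFreePath σ N), rowCount c σ N Φ k q z * (if T₂ < rowCount c σ N Φ k q z then 1 else 0) + (Cχ * (CΨ * Kx₁ + KxΨ) + 4 * Cχ / ϖ * (CΨ * S₁ + SΨ)) * (stepLen c σ N * (Real.sqrt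 (T₂ * ∑ q ∈ cellBox (c * meanFreePath σ N), rowCount c σ N Φ k q z) * Real.sqrt (2 * configEnergy z)))) := by
  intro σ N Φ z hz c hc hσ hσ2 χ Ψ hΨc r τ k S Cχ ρ ϖ CΨ S₁ Kt₁ Kx₁ SΨ KtΨ KxΨ T₂ η₁ hkS hχ hχuc hϖ hΔϖ hΨ hS1 hL1 hSΨ hLΨ
    hKt₁ hKx₁ hKtΨ hKxΨ hT₂ hη₁
  -- notation
  set Δ := stepLen c σ N with hΔdef
  set B := cellBox (c * meanFreePath σ N) with hB
  set T := collTriples Φ (stepWindow c σ N k) z with hT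
  set nc := cellCount c σ N * c with hnc
  set CP := CΨ * S₁ + SΨ with hCP
  set α := Cχ * (CΨ * Kt₁ + KtΨ) * Δ + Cχ * (CΨ * Kx₁ + KxΨ) * (Real.sqrt 3 / 2 * Δ) + ρ * CP with hα
  set β := Cχ * (CΨ * Kx₁ + KxΨ) + 4 * Cχ / ϖ * CP with hβ
  set R := ∑ q ∈ B, rowCount c σ N Φ k q z with hR
  set U := ∑ q ∈ B, rowCount c σ N Φ k q z * (if T₂ < rowCount c σ N Φ k q z then 1 else 0) with hU
  set BW := ∑ q ∈ B, badWeight Ψ η₁ (2 * T₂) c σ N Φ k q z with hBW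
  set dS : ℝ × Fin (N + 1) × Fin (N + 1) → ℝ := fun e => dockSummand χ Ψ r τ σ N Φ z e.1 (Φ.flow e.1 z) e.2.1 e.2.2
    with hdS
  set dM : ℝ × Fin (N + 1) × Fin (N + 1) → ℝ := fun e => dockMain χ Ψ r τ c σ N Φ k z e with hdM
  set good : ℝ × Fin (N + 1) × Fin (N + 1) → Prop := fun e => rowCount c σ N Φ k (startCell c σ N Φ k z e.2.1) z ≤ T₂
    with hgooddef
  -- signs
  have hΔ : 0 < Δ := stepLen_pos hc hσ N
  have hncpos : 0 < nc := mul_pos (cellCount_pos hc hσ N) hc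
  have hk0 : 0 ≤ (k : ℝ) * Δ := by positivity
  have hkΔS : (k : ℝ) * Δ ∈ Icc 0 S := ⟨hk0, le_trans (by nlinarith) hkS⟩
  have hCχ : 0 ≤ Cχ := (abs_nonneg _).trans (hχ ((k : ℝ) * Δ, cellCentre c σ N 0) hkΔS)
  have hCΨ : 0 ≤ CΨ := (abs_nonneg _).trans (hΨ 0)
  have hS1' : 0 ≤ S₁ := (abs_nonneg _).trans (hS1 0 (cellCentre c σ N 0))
  have hSΨ' : 0 ≤ SΨ := (abs_nonneg _).trans (hSΨ 0 (cellCentre c σ N 0))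
  have hρ : 0 ≤ ρ := by
    have h := hχuc ((k : ℝ) * Δ, cellCentre c σ N 0) ((k : ℝ) * Δ, cellCentre c σ N 0) hkΔS hkΔS (by simp [hϖ])
      (by rw [Torus.euclidDist_self]; exact hϖ)
    rwa [sub_self, abs_zero] at h
  have hCP0 : 0 ≤ CP := by positivity
  have hα0 : 0 ≤ α := by positivity
  have hβ0 : 0 ≤ β := by positivity
  have hR0 : 0 ≤ R := Finset.sum_nonneg fun q _ => rowCount_nonneg hc.le hσ Φ k q z
  -- decomposition: frozen main terms + good rows + bad rows
  have hdecomp : ∑ e ∈ T, dS e = ∑ e ∈ T, dM e +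
      (∑ e ∈ T.filter good, (dS e - dM e) + ∑ e ∈ T.filter (fun e => ¬ good e), (dS e - dM e)) := by
    rw [Finset.sum_filter_add_sum_filter_not, Finset.sum_sub_distrib]
    ring
  -- the frozen main terms
  have hmain : |∑ e ∈ T, dM e| ≤ nc * (Cχ * ∑ q ∈ B, (∑' q' : Cell, collPair (fun _ => 1) c σ N Φ k q q' z *
      |targetPm (fun _ => 1) r τ σ N Φ z ((k : ℝ) * Δ) (cellCentre c σ N q) *
          (pairPair Ψ c σ N Φ k q q' z / pairPair (fun _ => 1) c σ N Φ k q q' z) -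
        targetPm Ψ r τ σ N Φ z ((k : ℝ) * Δ) (cellCentre c σ N q)|) +
      Cχ * S₁ * (2 * η₁ * R + 2 * CΨ * BW + 4 * CΨ * U)) := by
    have hsum := sum_dockMain_eq Φ hz χ Ψ r τ hc hσ k
    simp only [hdM]
    rw [hsum, abs_mul, abs_of_pos hncpos]
    refine mul_le_mul_of_nonneg_left ?_ hncpos.le
    have hχ' : ∀ q ∈ B, |χ ((k : ℝ) * Δ, cellCentre c σ N q)| ≤ Cχ := fun q _ => hχ _ hkΔS
    have hS1k : ∀ x, |targetPm (fun _ => 1) r τ σ N Φ z ((k : ℝ) * Δ) x| ≤ S₁ := fun x => hS1 _ _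
    have h1 := abs_stepMain_le Φ hz χ hΨ r τ hc hσ k hχ' hS1k
    have h2 := sum_collPair_mul_abs_relDefect_le Φ hz hΨc hΨ hc hσ hσ2 k hη₁ (by positivity : (0 : ℝ) ≤ 2 * T₂)
    have h22 : (2 * T₂) / 2 = T₂ := by ring
    simp only [h22] at h2
    have h3 : ∑ q ∈ B, (η₁ * ownedCount c σ N Φ k q z + 2 * CΨ * (badWeight Ψ η₁ (2 * T₂) c σ N Φ k q z +
        2 * (rowCount c σ N Φ k q z * (if T₂ < rowCount c σ N Φ k q z then 1 else 0)))) ≤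
        2 * η₁ * R + 2 * CΨ * BW + 4 * CΨ * U := by
      calc _ ≤ ∑ q ∈ B, (η₁ * (2 * rowCount c σ N Φ k q z) + 2 * CΨ * (badWeight Ψ η₁ (2 * T₂) c σ N Φ k q z +
            2 * (rowCount c σ N Φ k q z * (if T₂ < rowCount c σ N Φ k q z then 1 else 0)))) :=
            Finset.sum_le_sum fun q _ => by
              have hown := ownedCount_le_two_mul_rowCount Φ hz hc hσ hσ2 k q
              gcongr
        _ = 2 * η₁ * R + 2 * CΨ * BW + 4 * CΨ * U := by
            rw [hR, hBW, hU, Finset.mul_sum, Finset.mul_sum, Finset.mul_sum, ← Finset.sum_add_distrib,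
              ← Finset.sum_add_distrib]
            refine Finset.sum_congr rfl fun q _ => ?_
            ring
    have hCS : 0 ≤ Cχ * S₁ := by positivity
    exact h1.trans (add_le_add le_rfl (mul_le_mul_of_nonneg_left (h2.trans h3) hCS))
  -- the good rows: replacement inequality and the in-step path lengths
  have hgood : |∑ e ∈ T.filter good, (dS e - dM e)| ≤
      α * (nc * R) + β * (Δ * (nc * Real.sqrt (T₂ * R) * Real.sqrt (2 * configEnergy z))) := by
    have hcard : (((T.filter good).card : ℕ) : ℝ) ≤ (T.card : ℝ) := by
      exact_mod_cast Finset.card_le_card (Finset.filter_subset _ T)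
    have hsqrt : Real.sqrt (nc * T₂ * (T.card : ℝ)) = nc * Real.sqrt (T₂ * R) := by
      rw [hT, card_collTriples_stepWindow_eq Φ hz hc hσ k, ← hnc, ← hR,
        show nc * T₂ * (nc * R) = (nc * nc) * (T₂ * R) by ring, Real.sqrt_mul (mul_self_nonneg nc),
        Real.sqrt_mul_self hncpos.le]
    calc |∑ e ∈ T.filter good, (dS e - dM e)| ≤ ∑ e ∈ T.filter good, |dS e - dM e| := Finset.abs_sum_le_sum_abs _ _
      _ ≤ ∑ e ∈ T.filter good, (α + β * stepPath c σ N Φ k z e.2.1) := Finset.sum_le_sum fun e he =>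
          abs_dockSummand_sub_dockMain_le Φ hz hc hσ χ Ψ r τ (Finset.mem_filter.1 he).1 hkS hχ hχuc hϖ hΔϖ hΨ
            hS1 hL1 hSΨ hLΨ hKt₁ hKx₁ hKtΨ hKxΨ
      _ = α * (((T.filter good).card : ℕ) : ℝ) + β * ∑ e ∈ T.filter good, stepPath c σ N Φ k z e.2.1 := by
          rw [Finset.sum_add_distrib, Finset.sum_const, nsmul_eq_mul, ← Finset.mul_sum]
          ring
      _ ≤ α * (T.card : ℝ) + β * (Δ * (Real.sqrt (nc * T₂ * (T.card : ℝ)) * Real.sqrt (2 * configEnergy z))) :=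
          add_le_add (mul_le_mul_of_nonneg_left hcard hα0)
            (mul_le_mul_of_nonneg_left (sum_stepPath_good_le Φ hz hc hσ k hT₂) hβ0)
      _ = α * (nc * R) + β * (Δ * (nc * Real.sqrt (T₂ * R) * Real.sqrt (2 * configEnergy z))) := by
          rw [hsqrt, hT, card_collTriples_stepWindow_eq Φ hz hc hσ k]
  -- the bad rows: crude bounds
  have hbad : |∑ e ∈ T.filter (fun e => ¬ good e), (dS e - dM e)| ≤ 2 * (Cχ * CP) * (nc * U) := by
    have hfilt : T.filter (fun e => ¬ good e) =
        T.filter (fun e => T₂ < rowCount c σ N Φ k (startCell c σ N Φ k z e.2.1) z) :=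
      Finset.filter_congr fun e _ => not_le
    rw [hfilt]
    calc |∑ e ∈ T.filter (fun e => T₂ < rowCount c σ N Φ k (startCell c σ N Φ k z e.2.1) z), (dS e - dM e)|
        ≤ ∑ e ∈ T.filter (fun e => T₂ < rowCount c σ N Φ k (startCell c σ N Φ k z e.2.1) z), |dS e - dM e| :=
          Finset.abs_sum_le_sum_abs _ _
      _ ≤ ∑ _e ∈ T.filter (fun e => T₂ < rowCount c σ N Φ k (startCell c σ N Φ k z e.2.1) z), (Cχ * CP + Cχ * CP) :=
          Finset.sum_le_sum fun e he => (abs_sub _ _).trans (add_le_add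
            (abs_dockSummand_le Φ hz hc hσ χ Ψ r τ (Finset.mem_filter.1 he).1 hkS hχ hΨ hS1 hSΨ)
            (abs_dockMain_le Φ hc hσ χ Ψ r τ k z e hkS hχ hΨ hS1 hSΨ))
      _ = 2 * (Cχ * CP) *
          (((T.filter fun e => T₂ < rowCount c σ N Φ k (startCell c σ N Φ k z e.2.1) z).card : ℕ) : ℝ) := by
          rw [Finset.sum_const, nsmul_eq_mul]
          ring
      _ = 2 * (Cχ * CP) * (nc * U) := by rw [hT, card_filter_bad_eq Φ hz hc hσ k T₂]
  -- assemble
  rw [hdecomp]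
  calc |∑ e ∈ T, dM e + (∑ e ∈ T.filter good, (dS e - dM e) + ∑ e ∈ T.filter (fun e => ¬ good e), (dS e - dM e))|
      ≤ |∑ e ∈ T, dM e| + (|∑ e ∈ T.filter good, (dS e - dM e)| + |∑ e ∈ T.filter (fun e => ¬ good e), (dS e - dM e)|) :=
        (abs_add_le _ _).trans (add_le_add le_rfl (abs_add_le _ _))
    _ ≤ _ := add_le_add hmain (add_le_add hgood hbad)
    _ = _ := by ring

/-! ## The deterministic bound -/

set_option maxHeartbeats 400000 in
/-- **Registered helper `abs_dockDefect_le` (piece F2 of the docking S7): the deterministic bound of the target's defect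
on a good orbit.** At ONE good initial datum `z` with no pair in contact, for `0 < σ < 1/2`, `0 < c`, a horizon `τ > 0`
with `Δ ≤ τ`, `Δ ≤ 1`, `τ + Δ ≤ S` (`Δ = stepLen c σ N`), a localiser `χ` bounded by `Cχ` and `(ρ, ϖ)`-uniformly continuous
on `[0, S] × 𝕋³` (`Δ < ϖ/2`), a continuous mark `|Ψ| ≤ CΨ`, sup / joint-Lipschitz bounds `S₁, S_Ψ, Kt, Kx` of the two
mollified pair fields of the orbit, a level `T₂ ≥ 0`, a tolerance `η₁ ≥ 0`, an energy constant `Q ≥ 0` with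
`2 T₂ h³ E(z) ≤ Q²`, and the three GOOD-EVENT inequalities — the unit average of the `NoMesoscopicOscillation` (i) integrand
(`Ξ := Ψ`) is `≤ ηN`, that of `badWeight Ψ η₁ (2T₂)` is `≤ b₁`, and that of `rowCount · 𝟙{T₂ < rowCount}` over the DOUBLED
horizon `2τ` is `≤ b₂` — the defect obeys `|dockDefect| ≤ π σ³ · BOUND`, `BOUND` the bracket of `docking_budget`:
time tiling (`dockDefect_eq_sum`, no time-`0` term), one step at a time (`abs_sum_dockSummand_step_le`), the tail inside
step `K_N` (`abs_sum_dockSummand_tail_le`), and the unit-average dictionary (`ε/(N+1) · (n̄c) = π σ³ Δ h³`,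
`stepLen_mul_sum_range_le_unitAvg` with `K_N + 1 ≤ K_{2τ}`, the level split `mul_sum_rowCount_le`, `K_N Δ ≤ τ`).
[folklore] -/
theorem abs_dockDefect_le : ∀ {σ : ℝ} {N : ℕ} (Φ : Flow σ N) {z : Phase N}, z ∈ Φ.good → (¬ ∃ i j : Fin (N + 1), i ≠ j ∧ z ∈ contactSet G3 (N + 1) (hsDiameter σ N) i j) → ∀ {c : ℝ}, 0 < c → 0 < σ → σ < 2⁻¹ → ∀ (χ : ℝ × T3 → ℝ) {Ψ : V3 × V3 × V3 → ℝ}, Continuous Ψ → ∀ (r : ℝ) {τ : ℝ}, 0 < τ → stepLen c σ N ≤ τ → stepLen c σ N ≤ 1 → ∀ {S Cχ ρ ϖ CΨ S₁ Kt₁ Kx₁ SΨ KtΨ KxΨ T₂ η₁ Q ηN b₁ b₂ : ℝ}, τ + stepLen c σ N ≤ S → (∀ p : ℝ × T3, p.1 ∈ Icc 0 S → |χ p| ≤ Cχ) → (∀ p p' : ℝ × T3, p.1 ∈ Icc 0 S → p'.1 ∈ Icc 0 S → |p.1 - p'.1| < ϖ → Torus.euclidDist p.2 p'.2 < ϖ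 → |χ p - χ p'| ≤ ρ) → 0 < ϖ → stepLen c σ N < ϖ / 2 → (∀ p, |Ψ p| ≤ CΨ) → (∀ s x, |targetPm (fun _ => 1) r τ σ N Φ z s x| ≤ S₁) → (∀ s x s' x', |targetPm (fun _ => 1) r τ σ N Φ z s x - targetPm (fun _ => 1) r τ σ N Φ z s' x'| ≤ Kt₁ * |s - s'| + Kx₁ * Torus.euclidDist x x') → (∀ s x, |targetPm Ψ r τ σ N Φ z s x| ≤ SΨ) → (∀ s x s' x', |targetPm Ψ r τ σ N Φ z s x - targetPm Ψ r τ σ N Φ z s' x'| ≤ KtΨ * |s - s'| + KxΨ * Torus.euclidDist x x') → 0 ≤ Kt₁ → 0 ≤ Kx₁ → 0 ≤ KtΨ → 0 ≤ KxΨ → 0 ≤ T₂ → 0 ≤ η₁ → 0 ≤ Q → 2 * T₂ * (c * meanFreePath σ N) ^ 3 * configEnergy z ≤ Q ^ 2 → unitAvg c σ N τ (fun k q => ∑' q' : Cell, collPair (fun _ => 1) c σ N Φ k q q' z * |targetPm (fun _ => 1) r τ σ N Φ z ((k : ℝ) * stepLen c σ N) (cellCentre c σ N q) * (pairPair Ψ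 c σ N Φ k q q' z / pairPair (fun _ => 1) c σ N Φ k q q' z) - targetPm Ψ r τ σ N Φ z ((k : ℝ) * stepLen c σ N) (cellCentre c σ N q)|) ≤ ηN → unitAvg c σ N τ (fun k q => badWeight Ψ η₁ (2 * T₂) c σ N Φ k q z) ≤ b₁ → unitAvg c σ N (2 * τ) (fun k q => rowCount c σ N Φ k q z * (if T₂ < rowCount c σ N Φ k q z then 1 else 0)) ≤ b₂ → |dockDefect χ Ψ r τ σ N Φ z| ≤ Real.pi * σ ^ 3 * (Cχ * τ * ηN + Cχ * S₁ * (2 * η₁ * (27 * T₂ * τ + 2 * τ * b₂) + 2 * CΨ * τ * b₁ + 4 * CΨ * (2 * τ * b₂)) + (Cχ * (CΨ * Kt₁ + KtΨ) * stepLen c σ N + Cχ * (CΨ * Kx₁ + KxΨ) * (Real.sqrt 3 / 2 * stepLen c σ N) + ρ * (CΨ * S₁ + SΨ)) * (27 * T₂ * τ + 2 * τ * b₂) + (Cχ * (CΨ * Kx₁ + KxΨ) + 4 * Cχ / ϖ * (CΨ * S₁ + SΨ)) * (Q * stepLen c σ N * (τ + 27 * T₂ * τ + 2 * τ * b₂))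 + 2 * (Cχ * (CΨ * S₁ + SΨ)) * (2 * τ * b₂) + Cχ * (CΨ * S₁ + SΨ) * (27 * T₂ * stepLen c σ N + 2 * τ * b₂)) := by
  intro σ N Φ z hz h0 c hc hσ hσ2 χ Ψ hΨc r τ hτ hΔτ hΔ1 S Cχ ρ ϖ CΨ S₁ Kt₁ Kx₁ SΨ KtΨ KxΨ T₂ η₁ Q ηN b₁ b₂ hS hχ hχuc hϖ
    hΔϖ hΨ hS1 hL1 hSΨ hLΨ hKt₁ hKx₁ hKtΨ hKxΨ hT₂ hη₁ hQ0 hQ hN hK hU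
  -- notation
  set Δ := stepLen c σ N with hΔdef
  set hh := c * meanFreePath σ N with hhdef
  set B := cellBox hh with hB
  set K := numSteps c σ N τ with hKdef
  set nc := cellCount c σ N * c with hnc
  set w := hsDiameter σ N / ((N : ℝ) + 1) with hw
  set P := Real.pi * σ ^ 3 with hP
  set CP := CΨ * S₁ + SΨ with hCP
  set α := Cχ * (CΨ * Kt₁ + KtΨ) * Δ + Cχ * (CΨ * Kx₁ + KxΨ) * (Real.sqrt 3 / 2 * Δ) + ρ * CP with hα
  set β := Cχ * (CΨ * Kx₁ + KxΨ) + 4 * Cχ / ϖ * CP with hβ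
  set E := configEnergy z with hE
  -- the per-step box sums
  set NMO : ℕ → ℝ := fun k => ∑ q ∈ B, (∑' q' : Cell, collPair (fun _ => 1) c σ N Φ k q q' z *
      |targetPm (fun _ => 1) r τ σ N Φ z ((k : ℝ) * Δ) (cellCentre c σ N q) *
          (pairPair Ψ c σ N Φ k q q' z / pairPair (fun _ => 1) c σ N Φ k q q' z) -
        targetPm Ψ r τ σ N Φ z ((k : ℝ) * Δ) (cellCentre c σ N q)|) with hNMO
  set R : ℕ → ℝ := fun k => ∑ q ∈ B, rowCount c σ N Φ k q z with hR
  set BW : ℕ → ℝ := fun k => ∑ q ∈ B, badWeight Ψ η₁ (2 * T₂) c σ N Φ k q z with hBW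
  set U : ℕ → ℝ := fun k => ∑ q ∈ B, rowCount c σ N Φ k q z * (if T₂ < rowCount c σ N Φ k q z then 1 else 0) with hU'
  -- signs and kinetic units
  have hΔ : 0 < Δ := stepLen_pos hc hσ N
  have hh0 : 0 < hh := mul_pos hc (meanFreePath_pos hσ N)
  have hh3 : 0 ≤ hh ^ 3 := by positivity
  have hncpos : 0 < nc := mul_pos (cellCount_pos hc hσ N) hc
  have hP0 : 0 < P := by positivity
  have hw0 : 0 ≤ w := div_nonneg (hsDiameter_pos hσ N).le (by positivity)
  have hW : w * nc = P * Δ * hh ^ 3 := pairWeight_mul_cellCount' σ c N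
  have hKΔ : (K : ℝ) * Δ ≤ τ := numSteps_mul_stepLen_le hc hσ hτ.le N
  have hKS : ((K : ℝ) + 1) * Δ ≤ S := by linarith
  have hKK : K + 1 ≤ numSteps c σ N (2 * τ) := numSteps_succ_le_numSteps_two_mul hc hσ hτ.le hΔτ
  have hS0 : (0 : ℝ) ≤ S := by linarith
  have hCχ : 0 ≤ Cχ := (abs_nonneg _).trans (hχ (0, cellCentre c σ N 0) ⟨le_rfl, hS0⟩)
  have hCΨ : 0 ≤ CΨ := (abs_nonneg _).trans (hΨ 0)
  have hS1' : 0 ≤ S₁ := (abs_nonneg _).trans (hS1 0 (cellCentre c σ N 0))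
  have hSΨ' : 0 ≤ SΨ := (abs_nonneg _).trans (hSΨ 0 (cellCentre c σ N 0))
  have hρ : 0 ≤ ρ := by
    have h := hχuc (0, cellCentre c σ N 0) (0, cellCentre c σ N 0) ⟨le_rfl, hS0⟩ ⟨le_rfl, hS0⟩ (by simp [hϖ])
      (by rw [Torus.euclidDist_self]; exact hϖ)
    rwa [sub_self, abs_zero] at h
  have hCP0 : 0 ≤ CP := by positivity
  have hα0 : 0 ≤ α := by positivity
  have hβ0 : 0 ≤ β := by positivity
  have hR0 : ∀ k, 0 ≤ R k := fun k => Finset.sum_nonneg fun q _ => rowCount_nonneg hc.le hσ Φ k q z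
  have hU0 : ∀ k, 0 ≤ U k := fun k => Finset.sum_nonneg fun q _ =>
    mul_nonneg (rowCount_nonneg hc.le hσ Φ k q z) (by positivity)
  -- box support and signs of the three averaged families
  have hFN : ∀ k, ∀ q ∉ B, (∑' q' : Cell, collPair (fun _ => 1) c σ N Φ k q q' z *
      |targetPm (fun _ => 1) r τ σ N Φ z ((k : ℝ) * Δ) (cellCentre c σ N q) *
          (pairPair Ψ c σ N Φ k q q' z / pairPair (fun _ => 1) c σ N Φ k q q' z) -
        targetPm Ψ r τ σ N Φ z ((k : ℝ) * Δ) (cellCentre c σ N q)|) = 0 := fun k q hq => by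
    simp only [collPair_eq_zero_of_not_mem hh0 _ Φ k (Or.inl hq) z, zero_mul, tsum_zero]
  have hFN0 : ∀ (k : ℕ) (q : Cell), 0 ≤ ∑' q' : Cell, collPair (fun _ => 1) c σ N Φ k q q' z *
      |targetPm (fun _ => 1) r τ σ N Φ z ((k : ℝ) * Δ) (cellCentre c σ N q) *
          (pairPair Ψ c σ N Φ k q q' z / pairPair (fun _ => 1) c σ N Φ k q q' z) -
        targetPm Ψ r τ σ N Φ z ((k : ℝ) * Δ) (cellCentre c σ N q)| := fun k q =>
    tsum_nonneg fun q' => mul_nonneg (collPair_one_nonneg hc.le hσ Φ k q q' z) (abs_nonneg _)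
  have hFB : ∀ k, ∀ q ∉ B, badWeight Ψ η₁ (2 * T₂) c σ N Φ k q z = 0 := fun k q hq =>
    badWeight_eq_zero_of_not_mem hh0 Ψ η₁ (by positivity) Φ k hq z
  have hFB0 : ∀ (k : ℕ) (q : Cell), 0 ≤ badWeight Ψ η₁ (2 * T₂) c σ N Φ k q z := fun k q =>
    badWeight_nonneg hc.le hσ Ψ η₁ (by positivity) Φ k q z
  have hFU : ∀ k, ∀ q ∉ B, rowCount c σ N Φ k q z * (if T₂ < rowCount c σ N Φ k q z then 1 else 0) = 0 :=
    fun k q hq => by rw [rowCount_eq_zero_of_not_mem hh0 Φ k hq z, zero_mul]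
  have hFU0 : ∀ (k : ℕ) (q : Cell), 0 ≤ rowCount c σ N Φ k q z * (if T₂ < rowCount c σ N Φ k q z then 1 else 0) :=
    fun k q => mul_nonneg (rowCount_nonneg hc.le hσ Φ k q z) (by positivity)
  -- the dictionary: partial step sums against the three good-event averages
  have DN : Δ * hh ^ 3 * ∑ k ∈ Finset.range K, NMO k ≤ τ * ηN :=
    (stepLen_mul_sum_range_le_unitAvg hc hσ hτ.le le_rfl hFN hFN0).trans (mul_le_mul_of_nonneg_left hN hτ.le)
  have DB : Δ * hh ^ 3 * ∑ k ∈ Finset.range K, BW k ≤ τ * b₁ :=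
    (stepLen_mul_sum_range_le_unitAvg hc hσ hτ.le le_rfl hFB hFB0).trans (mul_le_mul_of_nonneg_left hK hτ.le)
  have DU1 : Δ * hh ^ 3 * ∑ k ∈ Finset.range (K + 1), U k ≤ 2 * τ * b₂ :=
    (stepLen_mul_sum_range_le_unitAvg hc hσ (by positivity) hKK hFU hFU0).trans
      (mul_le_mul_of_nonneg_left hU (by positivity))
  have DU : Δ * hh ^ 3 * ∑ k ∈ Finset.range K, U k ≤ 2 * τ * b₂ := by
    refine le_trans (mul_le_mul_of_nonneg_left (Finset.sum_le_sum_of_subset_of_nonneg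
      (Finset.range_mono (Nat.le_succ K)) fun k _ _ => hU0 k) (by positivity)) DU1
  have DUK : Δ * hh ^ 3 * U K ≤ 2 * τ * b₂ := by
    refine le_trans (mul_le_mul_of_nonneg_left ?_ (by positivity)) DU1
    exact Finset.single_le_sum (f := U) (fun k _ => hU0 k) (Finset.self_mem_range_succ K)
  have DR : Δ * hh ^ 3 * ∑ k ∈ Finset.range K, R k ≤ 27 * T₂ * τ + 2 * τ * b₂ := by
    have hk : ∀ k, hh ^ 3 * R k ≤ 27 * T₂ + hh ^ 3 * U k := fun k => mul_sum_rowCount_le Φ hc hσ hΔ1 k z hT₂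
    calc Δ * hh ^ 3 * ∑ k ∈ Finset.range K, R k = Δ * ∑ k ∈ Finset.range K, hh ^ 3 * R k := mul_mul_sum _ _ _ _
      _ ≤ Δ * ∑ k ∈ Finset.range K, (27 * T₂ + hh ^ 3 * U k) :=
          mul_le_mul_of_nonneg_left (Finset.sum_le_sum fun k _ => hk k) hΔ.le
      _ = 27 * T₂ * ((K : ℝ) * Δ) + Δ * ∑ k ∈ Finset.range K, hh ^ 3 * U k := by
          rw [Finset.sum_add_distrib, Finset.sum_const, Finset.card_range, nsmul_eq_mul]
          ring
      _ = 27 * T₂ * ((K : ℝ) * Δ) + Δ * hh ^ 3 * ∑ k ∈ Finset.range K, U k := by rw [mul_mul_sum]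
      _ ≤ 27 * T₂ * τ + 2 * τ * b₂ := add_le_add (mul_le_mul_of_nonneg_left hKΔ (by positivity)) DU
  have DRK : Δ * hh ^ 3 * R K ≤ 27 * T₂ * Δ + 2 * τ * b₂ := by
    have hk : hh ^ 3 * R K ≤ 27 * T₂ + hh ^ 3 * U K := mul_sum_rowCount_le Φ hc hσ hΔ1 K z hT₂
    calc Δ * hh ^ 3 * R K = Δ * (hh ^ 3 * R K) := by ring
      _ ≤ Δ * (27 * T₂ + hh ^ 3 * U K) := mul_le_mul_of_nonneg_left hk hΔ.le
      _ = 27 * T₂ * Δ + Δ * hh ^ 3 * U K := by ring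
      _ ≤ 27 * T₂ * Δ + 2 * τ * b₂ := add_le_add le_rfl DUK
  have DE : Δ * hh ^ 3 * (Δ * ∑ k ∈ Finset.range K, Real.sqrt (T₂ * R k) * Real.sqrt (2 * E)) ≤
      Q * Δ * (τ + 27 * T₂ * τ + 2 * τ * b₂) := by
    have hsq : ∀ {x : ℝ}, 0 ≤ x → Real.sqrt x ≤ 1 + x := fun {x} hx => by
      rw [Real.sqrt_le_left (by positivity)]
      nlinarith [sq_nonneg x]
    have hk : ∀ k, hh ^ 3 * (Real.sqrt (T₂ * R k) * Real.sqrt (2 * E)) ≤ Q * (1 + hh ^ 3 * R k) := by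
      intro k
      have hTR : 0 ≤ T₂ * R k := mul_nonneg hT₂ (hR0 k)
      have hx : 0 ≤ hh ^ 3 * R k := mul_nonneg hh3 (hR0 k)
      calc hh ^ 3 * (Real.sqrt (T₂ * R k) * Real.sqrt (2 * E))
          = Real.sqrt ((2 * T₂ * hh ^ 3 * E) * (hh ^ 3 * R k)) := by
            conv_lhs => rw [← Real.sqrt_mul hTR, ← Real.sqrt_mul_self hh3, ← Real.sqrt_mul (mul_self_nonneg _)]
            congr 1
            ring
        _ ≤ Real.sqrt (Q ^ 2 * (hh ^ 3 * R k)) := Real.sqrt_le_sqrt (mul_le_mul_of_nonneg_right hQ hx)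
        _ = Q * Real.sqrt (hh ^ 3 * R k) := by rw [Real.sqrt_mul (sq_nonneg Q), Real.sqrt_sq hQ0]
        _ ≤ Q * (1 + hh ^ 3 * R k) := mul_le_mul_of_nonneg_left (hsq hx) hQ0
    calc Δ * hh ^ 3 * (Δ * ∑ k ∈ Finset.range K, Real.sqrt (T₂ * R k) * Real.sqrt (2 * E))
        = Δ * Δ * ∑ k ∈ Finset.range K, hh ^ 3 * (Real.sqrt (T₂ * R k) * Real.sqrt (2 * E)) := by
          rw [← Finset.mul_sum]
          ring
      _ ≤ Δ * Δ * ∑ k ∈ Finset.range K, Q * (1 + hh ^ 3 * R k) :=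
          mul_le_mul_of_nonneg_left (Finset.sum_le_sum fun k _ => hk k) (by positivity)
      _ = Q * Δ * ((K : ℝ) * Δ + Δ * hh ^ 3 * ∑ k ∈ Finset.range K, R k) := by
          rw [← Finset.mul_sum, Finset.sum_add_distrib, Finset.sum_const, Finset.card_range, nsmul_eq_mul, mul_one,
            ← Finset.mul_sum]
          ring
      _ ≤ Q * Δ * (τ + (27 * T₂ * τ + 2 * τ * b₂)) :=
          mul_le_mul_of_nonneg_left (add_le_add hKΔ DR) (by positivity)
      _ = Q * Δ * (τ + 27 * T₂ * τ + 2 * τ * b₂) := by ring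
  -- the defect as a sum over steps plus the tail (no contact pair at time `0`)
  have hdef := dockDefect_eq_sum Φ hz χ Ψ r hτ.le hc hσ
  rw [contactPairs_flow_zero_eq_empty Φ hz h0, Finset.sum_empty, zero_add] at hdef
  -- one step at a time, and the tail
  have hstep : ∀ k ∈ Finset.range K,
      |∑ e ∈ collTriples Φ (stepWindow c σ N k) z, dockSummand χ Ψ r τ σ N Φ z e.1 (Φ.flow e.1 z) e.2.1 e.2.2| ≤
        nc * (Cχ * NMO k + Cχ * S₁ * (2 * η₁ * R k + 2 * CΨ * BW k + 4 * CΨ * U k) + α * R k + 2 * (Cχ * CP) * U k +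
          β * (Δ * (Real.sqrt (T₂ * R k) * Real.sqrt (2 * E)))) := by
    intro k hk
    have hk' : (k : ℝ) + 1 ≤ K := by exact_mod_cast Finset.mem_range.1 hk
    have hkS : ((k : ℝ) + 1) * Δ ≤ S := (mul_le_mul_of_nonneg_right (by linarith) hΔ.le).trans hKS
    exact abs_sum_dockSummand_step_le Φ hz hc hσ hσ2 χ hΨc r τ k hkS hχ hχuc hϖ hΔϖ hΨ hS1 hL1 hSΨ hLΨ hKt₁ hKx₁ hKtΨ
      hKxΨ hT₂ hη₁
  have htail := abs_sum_dockSummand_tail_le Φ hz hc hσ χ Ψ r hKS hχ hΨ hS1 hSΨ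
  -- assemble
  rw [hdef, abs_mul, abs_of_nonneg hw0]
  calc w * |∑ k ∈ Finset.range K, ∑ e ∈ collTriples Φ (stepWindow c σ N k) z,
          dockSummand χ Ψ r τ σ N Φ z e.1 (Φ.flow e.1 z) e.2.1 e.2.2 +
        ∑ e ∈ collTriples Φ (Ioc ((K : ℝ) * Δ) τ) z, dockSummand χ Ψ r τ σ N Φ z e.1 (Φ.flow e.1 z) e.2.1 e.2.2|
      ≤ w * (∑ k ∈ Finset.range K, |∑ e ∈ collTriples Φ (stepWindow c σ N k) z,
          dockSummand χ Ψ r τ σ N Φ z e.1 (Φ.flow e.1 z) e.2.1 e.2.2| +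
        |∑ e ∈ collTriples Φ (Ioc ((K : ℝ) * Δ) τ) z, dockSummand χ Ψ r τ σ N Φ z e.1 (Φ.flow e.1 z) e.2.1 e.2.2|) :=
        mul_le_mul_of_nonneg_left ((abs_add_le _ _).trans (add_le_add (Finset.abs_sum_le_sum_abs _ _) le_rfl)) hw0
    _ ≤ w * (∑ k ∈ Finset.range K, nc * (Cχ * NMO k + Cχ * S₁ * (2 * η₁ * R k + 2 * CΨ * BW k + 4 * CΨ * U k) +
          α * R k + 2 * (Cχ * CP) * U k + β * (Δ * (Real.sqrt (T₂ * R k) * Real.sqrt (2 * E)))) +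
        Cχ * CP * (nc * R K)) :=
        mul_le_mul_of_nonneg_left (add_le_add (Finset.sum_le_sum hstep) htail) hw0
    _ = (w * nc) * (Cχ * ∑ k ∈ Finset.range K, NMO k +
          Cχ * S₁ * (2 * η₁ * ∑ k ∈ Finset.range K, R k + 2 * CΨ * ∑ k ∈ Finset.range K, BW k +
            4 * CΨ * ∑ k ∈ Finset.range K, U k) +
          α * ∑ k ∈ Finset.range K, R k + 2 * (Cχ * CP) * ∑ k ∈ Finset.range K, U k +
          β * (Δ * ∑ k ∈ Finset.range K, Real.sqrt (T₂ * R k) * Real.sqrt (2 * E)) + Cχ * CP * R K) := by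
        rw [← Finset.mul_sum]
        simp only [Finset.sum_add_distrib, ← Finset.mul_sum]
        ring
    _ = P * (Cχ * (Δ * hh ^ 3 * ∑ k ∈ Finset.range K, NMO k) +
          Cχ * S₁ * (2 * η₁ * (Δ * hh ^ 3 * ∑ k ∈ Finset.range K, R k) +
            2 * CΨ * (Δ * hh ^ 3 * ∑ k ∈ Finset.range K, BW k) + 4 * CΨ * (Δ * hh ^ 3 * ∑ k ∈ Finset.range K, U k)) +
          α * (Δ * hh ^ 3 * ∑ k ∈ Finset.range K, R k) + 2 * (Cχ * CP) * (Δ * hh ^ 3 * ∑ k ∈ Finset.range K, U k) +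
          β * (Δ * hh ^ 3 * (Δ * ∑ k ∈ Finset.range K, Real.sqrt (T₂ * R k) * Real.sqrt (2 * E))) +
          Cχ * CP * (Δ * hh ^ 3 * R K)) := by
        rw [hW]
        ring
    _ ≤ P * (Cχ * (τ * ηN) + Cχ * S₁ * (2 * η₁ * (27 * T₂ * τ + 2 * τ * b₂) + 2 * CΨ * (τ * b₁) + 4 * CΨ * (2 * τ * b₂)) +
          α * (27 * T₂ * τ + 2 * τ * b₂) + 2 * (Cχ * CP) * (2 * τ * b₂) + β * (Q * Δ * (τ + 27 * T₂ * τ + 2 * τ * b₂)) +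
          Cχ * CP * (27 * T₂ * Δ + 2 * τ * b₂)) := by
        gcongr
    _ = _ := by ring

end Summit.AtomisticToContinuum.HydrodynamicLimit.Theorems.EquilibriumForecastLine

end
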